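import Literature.NumberTheory.Rogawski1990.SingularEllipticTransfer
import Literature.NumberTheory.Rogawski1990.AdelicStableOrbitalIntegrableG2OfKConj
import Literature.NumberTheory.Rogawski1990.AdelicNormalisationSemisimple
import Literature.NumberTheory.Rogawski1990.LocalTransferFundamentalLemma
import Literature.NumberTheory.Rogawski1990.PureTensorPairRationalValue
import Literature.NumberTheory.Automorphic.GodementHeightFloor
import HarnessLib

/-!
# The κ-MASS identity of the singular elliptic transfer package, GLUED from its local letters
# (Rogawski 1990, §14.5 Lemma 14.5.2 (b) + proof p. 239; §8.2 Prop. 8.2.1 (a)(b) pp. 117–118; §4.3 p. 44)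

Topic `NumberTheory/Rogawski1990`; namespace `Literature.NumberTheory.Rogawski1990`; **THEOREMS ONLY** (no definition, no named fact, no instance, no notation,
no `sorry`).  Cell `pub/hodgecm-mathlib`, ENGINE T1 (crux H413 = `stmt-HodgeConjecture-24833`), the «#88 side» (pay-down of ★ `SingularEllipticTransferCanonical`,
LEAD DESK WORDS T6-18∕T6-20, tree `F0/P3a/T6e-TREE.md`, census `F0/P3a/F0P3a-p08/CENSUS-88-kappaMass.F0P3a-p08g9.md`): node **P3 `stub_kappaMass_glue`** of the CUT B
(ED. 2) of the nested line `F0_P3a_SingularEllipticTransferPaydown`.  The (κ-MASS) clause of ★ `SingularEllipticTransfer` ∕ ★ `SingularEllipticTransferCanonical`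
(«at a split non-central singular `γ₀` with `charpoly = (X − e₁)²(X − e₂)` and partner `γ_H = (e₁•1₂, e₂)` there is ONE `C > 0` with
`Σ_{𝒞_𝐀(γ₀)} Φ(f′) = C · f^H(γ_H ⊗ 1)` for every Δ-transfer pure-tensor pair») is DERIVED from the letters print proves place by place — (κ-loc) [Prop. 8.2.1 (a),
8.1.3: `Φ^st_v((γ₀)_v, f_v) = c_v · f^H_v((γ_H)_v)` for Δ_v-transfer pairs of smooth functions], its a.e. clause [`c_v = 1` off a finite `S_c`], (κ-arch) [L. 14.5.2 (b)
at `∞`: `Φ^st_∞(γ₀ ⊗ 1, a) = c_∞ · a^H(γ_H ⊗ 1)`], (κ-sign) [Prop. 8.2.1 (b), the product formula at `γ₀`: `c_∞ · ∏_{v ∈ S_c} c_v = r > 0`] — by the EULER PRODUCT of the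
adelic stable orbital sum at the split-singular class (★ `MatchingAdeleG₂.exists_forall_isEulerOnClasses_ofLocalAdelic_of_mul_sub_eq_zero`, kit-side binders only:
class-local admissibility (ADM) and normalisation (NORM) at `γ₀`, ★ `MatchingAdeleG₂.forall_exists_isNormalisedOff_of_mul_sub_eq_zero`) and the restricted-product
evaluation of the `H`-side pure tensor at the rational point `γ_H ⊗ 1` (★ `PureTensor₂.eval_eq_of_mem` ∕ `eval_eq_zero_of_not_mem`).

* **`kappaMass_of_singularLetters`** — `(κ-loc) ∧ (a.e.) ∧ (κ-arch) ∧ (κ-sign) ∧ (ADM)@γ₀ ∧ (NORM)@γ₀ ⟹ (κ-MASS)` (the conclusion is ★ `SingularEllipticTransfer`'s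
  (κ-MASS) text VERBATIM; the letters are the census' §4 texts VERBATIM).

HC_CM is proved only modulo the printed citations until rung 0 closes; this file consumes nothing printed (the letters are hypotheses).

## References
* [Rogawski1990] J. D. Rogawski, *Automorphic Representations of Unitary Groups in Three Variables*, Ann. of Math. Stud. 123 (1990), §14.5 Lemma 14.5.2 (b)
  pp. 238–239; §8.2 Prop. 8.2.1 (a), (b) pp. 117–118; §8.1 Prop. 8.1.3 p. 116; §4.3 (4.3.1) p. 43, p. 44; §4.9 p. 54.
* [Kottwitz1986] R. E. Kottwitz, *Stable trace formula: elliptic singular terms*, Math. Ann. 275 (1986), Prop. 7.1, Cor. 7.3.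
-/

set_option autoImplicit false

noncomputable section

open MeasureTheory Measure NumberField IsDedekindDomain
open Literature.MeasureTheory.Group
open scoped Matrix MatrixGroups

namespace Literature.NumberTheory.Rogawski1990

open Literature.NumberTheory.Automorphic
open Literature.AlgebraicGeometry.ShimuraVarieties (unitaryGroup hermForm)

section Glue

variable (L : Type) [Field L] [NumberField L] [IsCMField L] (H' : Matrix (Fin 3) (Fin 3) L) (Tinf : ArchTransferFactor L H')
variable (L : Type) [Field L] [NumberField L] [IsCMField L] (H' : Matrix (Fin 3) (Fin 3) L) (Tinf : ArchTransferFactor L H')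
    -- σ-algebras of the `G′ = U(H′)` side: the orbit quotients of the adelic ∕ archimedean ∕ local groups (the sub-list of ★ `SingularEllipticTransfer`'s frame the glue uses)
    [∀ g : (UnitaryGroup.cmDatum L 3 H').Adelic, MeasurableSpace ((UnitaryGroup.cmDatum L 3 H').Adelic ⧸ Subgroup.centralizer ({g} : Set (UnitaryGroup.cmDatum L 3 H').Adelic))]
    [∀ g : (UnitaryGroup.cmDatum L 3 H').Adelic, BorelSpace ((UnitaryGroup.cmDatum L 3 H').Adelic ⧸ Subgroup.centralizer ({g} : Set (UnitaryGroup.cmDatum L 3 H').Adelic))]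
    [∀ γ : UnitaryGroup.arch (↥(maximalRealSubfield L)) L (IsCMField.complexConj L) 3 H',
      MeasurableSpace (UnitaryGroup.arch (↥(maximalRealSubfield L)) L (IsCMField.complexConj L) 3 H' ⧸ Subgroup.centralizer ({γ} : Set (UnitaryGroup.arch (↥(maximalRealSubfield L)) L (IsCMField.complexConj L) 3 H')))]
    [∀ γ : UnitaryGroup.arch (↥(maximalRealSubfield L)) L (IsCMField.complexConj L) 3 H',
      BorelSpace (UnitaryGroup.arch (↥(maximalRealSubfield L)) L (IsCMField.complexConj L) 3 H' ⧸ Subgroup.centralizer ({γ} : Set (UnitaryGroup.arch (↥(maximalRealSubfield L)) L (IsCMField.complexConj L) 3 H')))]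
    [∀ (v : HeightOneSpectrum (𝓞 ↥(maximalRealSubfield L))) (γ : (UnitaryGroup.cmDatum L 3 H').Local v),
      MeasurableSpace ((UnitaryGroup.cmDatum L 3 H').Local v ⧸ Subgroup.centralizer ({γ} : Set ((UnitaryGroup.cmDatum L 3 H').Local v)))]
    [∀ (v : HeightOneSpectrum (𝓞 ↥(maximalRealSubfield L))) (γ : (UnitaryGroup.cmDatum L 3 H').Local v),
      BorelSpace ((UnitaryGroup.cmDatum L 3 H').Local v ⧸ Subgroup.centralizer ({γ} : Set ((UnitaryGroup.cmDatum L 3 H').Local v)))]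
    -- σ-algebras of the `H = U(Φ₂) × U(Φ₁)` side: the orbit quotients of `H_v` and `H_∞`
    [∀ (v : HeightOneSpectrum (𝓞 ↥(maximalRealSubfield L))) (a : ((UnitaryGroup.cmDatum L 2 (Matrix.of fun i j : Fin 2 => if i.val + j.val + 1 = 2 then (1 : L) else 0)).Local v ×
        (UnitaryGroup.cmDatum L 1 (Matrix.of fun i j : Fin 1 => if i.val + j.val + 1 = 1 then (1 : L) else 0)).Local v)),
      MeasurableSpace (((UnitaryGroup.cmDatum L 2 (Matrix.of fun i j : Fin 2 => if i.val + j.val + 1 = 2 then (1 : L) else 0)).Local v ×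
        (UnitaryGroup.cmDatum L 1 (Matrix.of fun i j : Fin 1 => if i.val + j.val + 1 = 1 then (1 : L) else 0)).Local v) ⧸ Subgroup.centralizer ({a} : Set ((UnitaryGroup.cmDatum L 2 (Matrix.of fun i j : Fin 2 => if i.val + j.val + 1 = 2 then (1 : L) else 0)).Local v ×
        (UnitaryGroup.cmDatum L 1 (Matrix.of fun i j : Fin 1 => if i.val + j.val + 1 = 1 then (1 : L) else 0)).Local v)))]
    [∀ a : (UnitaryGroup.arch (↥(maximalRealSubfield L)) L (IsCMField.complexConj L) 2 (Matrix.of fun i j : Fin 2 => if i.val + j.val + 1 = 2 then (1 : L) else 0) ×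
          UnitaryGroup.arch (↥(maximalRealSubfield L)) L (IsCMField.complexConj L) 1 (Matrix.of fun i j : Fin 1 => if i.val + j.val + 1 = 1 then (1 : L) else 0)),
      MeasurableSpace ((UnitaryGroup.arch (↥(maximalRealSubfield L)) L (IsCMField.complexConj L) 2 (Matrix.of fun i j : Fin 2 => if i.val + j.val + 1 = 2 then (1 : L) else 0) ×
          UnitaryGroup.arch (↥(maximalRealSubfield L)) L (IsCMField.complexConj L) 1 (Matrix.of fun i j : Fin 1 => if i.val + j.val + 1 = 1 then (1 : L) else 0)) ⧸ Subgroup.centralizer ({a} : Set (UnitaryGroup.arch (↥(maximalRealSubfield L)) L (IsCMField.complexConj L) 2 (Matrix.of fun i j : Fin 2 => if i.val + j.val + 1 = 2 then (1 : L) else 0) ×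
          UnitaryGroup.arch (↥(maximalRealSubfield L)) L (IsCMField.complexConj L) 1 (Matrix.of fun i j : Fin 1 => if i.val + j.val + 1 = 1 then (1 : L) else 0))))]

/-- **(κ-MASS) FROM ITS LETTERS.**  At a split non-central singular `γ₀ ∈ U(H′)(L⁺)` (`charpoly = (X − e₁)²(X − e₂)`, `e₁ ≠ e₂`) with partner
`γ_H = (e₁•1₂, e₂) ∈ H(L⁺)`, singular members `mGs`, `mGis` that are (ADM) admissible on the classes corresponding to `γ₀` and (NORM) normalised off a finite set at
`γ₀`, and place-by-place letters (κ-loc) `Φ^st_v((γ₀)_v, f) = c_v · f^H((γ_H)_v)` on smooth Δ_v-transfer pairs, `c_v = 1` off `S_c`, (κ-arch)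
`Φ^st_∞(γ₀ ⊗ 1, a) = c_∞ · a^H(γ_H ⊗ 1)` on smooth Δ_∞-transfer pairs, (κ-sign) `c_∞ · ∏_{v ∈ S_c} c_v = r > 0`: THEN (κ-MASS) — for every test pure tensor `T` on
`G′(𝐀)` and unramified pure tensor `T_H` on `H(𝐀)` in the Δ-transfer relations, `Σ_{𝒞_𝐀(γ₀)} Φ_{ofLocalAdelic mGs mGis}(T) = r · T_H(γ_H ⊗ 1)`.
Print: Lemma 14.5.2 (b) «`Φ^κ(γ′, f′) = f′^H(γ₀)`» from «`Δ_{G∕H}(γ₀)Φ(γ₀, f′_v) = f′^H_v(γ₀)`» at every `v` and the product formula `∏ Δ_v(γ₀) = 1` [Prop. 8.2.1 (b)].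
[cite: Rogawski1990, §14.5 Lemma 14.5.2 (b) pp. 238–239; §8.2 Prop. 8.2.1 (a), (b) pp. 117–118; §4.3 p. 44; §4.9 p. 54] [cite: Kottwitz1986, Prop. 7.1, Cor. 7.3] -/
theorem kappaMass_of_singularLetters
    (hherm : (H'.map (cmConjRingHom L)).transpose = H') (hanis : ∀ x : Fin 3 → L, hermForm (cmConjRingHom L) H' x x = 0 → x = 0)
    (Δ : ∀ v : HeightOneSpectrum (𝓞 ↥(maximalRealSubfield L)), LocalTransferFactor L H' v)
    (mH : ∀ v : HeightOneSpectrum (𝓞 ↥(maximalRealSubfield L)),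
      OrbitalMeasureFamily ((UnitaryGroup.cmDatum L 2 (Matrix.of fun i j : Fin 2 => if i.val + j.val + 1 = 2 then (1 : L) else 0)).Local v × (UnitaryGroup.cmDatum L 1 (Matrix.of fun i j : Fin 1 => if i.val + j.val + 1 = 1 then (1 : L) else 0)).Local v))
    (mG : ∀ v : HeightOneSpectrum (𝓞 ↥(maximalRealSubfield L)), OrbitalMeasureFamily ((UnitaryGroup.cmDatum L 3 H').Local v))
    (m' : OrbitalMeasureFamily (UnitaryGroup.arch (↥(maximalRealSubfield L)) L (IsCMField.complexConj L) 3 H'))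
    (mHi : OrbitalMeasureFamily (UnitaryGroup.arch (↥(maximalRealSubfield L)) L (IsCMField.complexConj L) 2 (Matrix.of fun i j : Fin 2 => if i.val + j.val + 1 = 2 then (1 : L) else 0) ×
      UnitaryGroup.arch (↥(maximalRealSubfield L)) L (IsCMField.complexConj L) 1 (Matrix.of fun i j : Fin 1 => if i.val + j.val + 1 = 1 then (1 : L) else 0)))
    (mGs : ∀ v : HeightOneSpectrum (𝓞 ↥(maximalRealSubfield L)), OrbitalMeasureFamily ((UnitaryGroup.cmDatum L 3 H').Local v))
    (mGis : OrbitalMeasureFamily (UnitaryGroup.arch (↥(maximalRealSubfield L)) L (IsCMField.complexConj L) 3 H'))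
    -- the (κ-MASS) binders `γ₀ e₁ e₂ hne hprod γH` VERBATIM (its `hnc hchar hγH1 hγH2` are not needed by the glue)
    (γ₀ : (UnitaryGroup.cmDatum L 3 H').Rational) (e₁ e₂ : L) (hne : e₁ ≠ e₂)
    (hprod : ((((γ₀ : unitaryGroup (cmConjRingHom L) H').val : GL (Fin 3) L) : Matrix (Fin 3) (Fin 3) L) - e₁ • (1 : Matrix (Fin 3) (Fin 3) L)) *
      ((((γ₀ : unitaryGroup (cmConjRingHom L) H').val : GL (Fin 3) L) : Matrix (Fin 3) (Fin 3) L) - e₂ • (1 : Matrix (Fin 3) (Fin 3) L)) = 0)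
    (γH : (UnitaryGroup.cmDatum L 2 (Matrix.of fun i j : Fin 2 => if i.val + j.val + 1 = 2 then (1 : L) else 0)).Rational × (UnitaryGroup.cmDatum L 1 (Matrix.of fun i j : Fin 1 => if i.val + j.val + 1 = 1 then (1 : L) else 0)).Rational)
    -- (ADM) at `γ₀` (first two conjuncts of ★ `SingularEllipticTransfer` :203) and (NORM) at `γ₀` (:216)
    (hadm : ∀ v, (mGs v).IsAdmissibleOn fun x : (UnitaryGroup.cmDatum L 3 H').Local v =>
      Corresponds (UnitaryGroup.conjLocal L (IsCMField.complexConj L) v)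
        ((UnitaryGroup.adelicForm L 3 H').map (UnitaryGroup.adeleToLocal L v))
        ((UnitaryGroup.adelicForm L 3 H').map (UnitaryGroup.adeleToLocal L v))
        ((UnitaryGroup.cmDatum L 3 H').toLocal v ((UnitaryGroup.cmDatum L 3 H').toAdelic γ₀)) x)
    (hadmA : mGis.IsAdmissibleOn (fun x : UnitaryGroup.arch (↥(maximalRealSubfield L)) L (IsCMField.complexConj L) 3 H' =>
      Corresponds (UnitaryGroup.conjMixed (↥(maximalRealSubfield L)) L (IsCMField.complexConj L)) (UnitaryGroup.archFormOf L 3 H')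
        (UnitaryGroup.archFormOf L 3 H') (cmRationalToArch L 3 H' γ₀) x))
    (hnormγ : ∃ S₀ : Finset (HeightOneSpectrum (𝓞 ↥(maximalRealSubfield L))), UnitaryGroup.IsNormalisedOff L 3 H' mGs ((UnitaryGroup.cmDatum L 3 H').toAdelic γ₀) S₀)
    -- the letters (κ-loc), (κ-arch), (κ-sign) (census §4 texts, LEAD DESK WORD T6-21 (2)) and P4's conclusion (the a.e. clause)
    (c : HeightOneSpectrum (𝓞 ↥(maximalRealSubfield L)) → ℂ) (cinf : ℂ)
    (hloc : ∀ (v : HeightOneSpectrum (𝓞 ↥(maximalRealSubfield L)))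
        (fH : (UnitaryGroup.cmDatum L 2 (Matrix.of fun i j : Fin 2 => if i.val + j.val + 1 = 2 then (1 : L) else 0)).Local v × (UnitaryGroup.cmDatum L 1 (Matrix.of fun i j : Fin 1 => if i.val + j.val + 1 = 1 then (1 : L) else 0)).Local v → ℂ) (f : (UnitaryGroup.cmDatum L 3 H').Local v → ℂ),
      IsLocSmooth f → IsLocSmooth fH → IsLocalDeltaTransfer L H' v (Δ v) (mH v) (mG v) fH f →
      localStableOrbitalIntegral L 3 H' v (mGs v) f ((UnitaryGroup.cmDatum L 3 H').toLocal v ((UnitaryGroup.cmDatum L 3 H').toAdelic γ₀)) =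
        c v * fH ((UnitaryGroup.cmDatum L 2 (Matrix.of fun i j : Fin 2 => if i.val + j.val + 1 = 2 then (1 : L) else 0)).toLocal v ((UnitaryGroup.cmDatum L 2 (Matrix.of fun i j : Fin 2 => if i.val + j.val + 1 = 2 then (1 : L) else 0)).toAdelic γH.1),
          (UnitaryGroup.cmDatum L 1 (Matrix.of fun i j : Fin 1 => if i.val + j.val + 1 = 1 then (1 : L) else 0)).toLocal v ((UnitaryGroup.cmDatum L 1 (Matrix.of fun i j : Fin 1 => if i.val + j.val + 1 = 1 then (1 : L) else 0)).toAdelic γH.2)))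
    (harch : ∀ (aH : UnitaryGroup.arch (↥(maximalRealSubfield L)) L (IsCMField.complexConj L) 2 (Matrix.of fun i j : Fin 2 => if i.val + j.val + 1 = 2 then (1 : L) else 0) ×
          UnitaryGroup.arch (↥(maximalRealSubfield L)) L (IsCMField.complexConj L) 1 (Matrix.of fun i j : Fin 1 => if i.val + j.val + 1 = 1 then (1 : L) else 0) → ℂ)
        (a : UnitaryGroup.arch (↥(maximalRealSubfield L)) L (IsCMField.complexConj L) 3 H' → ℂ),
      ArchSmooth L 3 H' a → ArchSmooth₂ L aH → IsArchDeltaTransfer L H' Tinf mHi m' aH a →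
      archStableOrbitalIntegral L 3 H' mGis a (cmRationalToArch L 3 H' γ₀) =
        cinf * aH (cmRationalToArch L 2 (Matrix.of fun i j : Fin 2 => if i.val + j.val + 1 = 2 then (1 : L) else 0) γH.1, cmRationalToArch L 1 (Matrix.of fun i j : Fin 1 => if i.val + j.val + 1 = 1 then (1 : L) else 0) γH.2))
    (hsign : ∀ S_c : Finset (HeightOneSpectrum (𝓞 ↥(maximalRealSubfield L))), (∀ v ∉ S_c, c v = 1) →
      ∃ r : ℝ, 0 < r ∧ cinf * ∏ v ∈ S_c, c v = (r : ℂ))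
    (hae : ∃ S_c : Finset (HeightOneSpectrum (𝓞 ↥(maximalRealSubfield L))), ∀ v ∉ S_c, c v = 1) :
    ∃ C : ℝ, 0 < C ∧
      ∀ (T : UnitaryGroup.PureTensor L 3 H')
        (TH : UnitaryGroup.PureTensor₂ L (Matrix.of fun i j : Fin 2 => if i.val + j.val + 1 = 2 then (1 : L) else 0) (Matrix.of fun i j : Fin 1 => if i.val + j.val + 1 = 1 then (1 : L) else 0)),
        T.IsTest → TH.IsUnramified₂ → (∀ v ∈ TH.S, IsLocSmooth (TH.loc v)) → ArchSmooth₂ L TH.arch →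
        (∀ v, IsLocalDeltaTransfer L H' v (Δ v) (mH v) (mG v) (TH.loc v) (T.loc v)) →
        IsArchDeltaTransfer L H' Tinf mHi m' TH.arch T.arch →
        adelicStableOrbitalSum (MatchingAdeleG₂.classes L H' H' γ₀)
            (UnitaryGroup.OrbitalMeasureFamily.ofLocalAdelic L 3 H' mGs mGis) T.eval =
          (C : ℂ) * TH.eval ((UnitaryGroup.cmDatum L 2 (Matrix.of fun i j : Fin 2 => if i.val + j.val + 1 = 2 then (1 : L) else 0)).toAdelic γH.1,
            (UnitaryGroup.cmDatum L 1 (Matrix.of fun i j : Fin 1 => if i.val + j.val + 1 = 1 then (1 : L) else 0)).toAdelic γH.2) := by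
  classical
  obtain ⟨Sc, hSc⟩ := hae
  obtain ⟨r, hr, hr'⟩ := hsign Sc hSc
  refine ⟨r, hr, fun T TH hT hTH hTHs hTHa hLT hAT => ?_⟩
  -- Step 1: the kit-side letters at `H₁ = H₂ = H′`, `γ := γ₀`
  have hdet : H'.det ≠ 0 := Godement.det_ne_zero_of_anisotropic L H' hanis
  have hγ : Corresponds (cmConjRingHom L) H' H' γ₀ γ₀ := corresponds_self_iff.2 (IsStablyConj.refl _)
  -- Step 2: normalisation at every matching adèle from (NORM) at `γ₀`
  have hnorm := MatchingAdeleG₂.forall_exists_isNormalisedOff_of_mul_sub_eq_zero hherm hdet hγ hne hprod mGs hadm hnormγ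
  -- Step 3: the Euler head at the split-singular class
  have h0 := MatchingAdeleG₂.exists_forall_isEulerOnClasses_ofLocalAdelic_of_mul_sub_eq_zero hherm hdet hγ hne hprod mGs mGis
    hadm hadmA hnormγ hnorm T hT
  obtain ⟨S₁, hS₁⟩ := h0
  -- Step 4: a finite set off which `(γ_H)_v` lies in the levels of `T_H`
  have h1 := UnitaryGroup.PureTensor₂.exists_finset_forall_mem_level L TH hTH
    ((UnitaryGroup.cmDatum L 2 (Matrix.of fun i j : Fin 2 => if i.val + j.val + 1 = 2 then (1 : L) else 0)).toAdelic γH.1,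
      (UnitaryGroup.cmDatum L 1 (Matrix.of fun i j : Fin 1 => if i.val + j.val + 1 = 1 then (1 : L) else 0)).toAdelic γH.2)
  obtain ⟨SH, hTSH, hpH⟩ := h1
  have hE := hS₁ (S₁ ∪ Sc ∪ SH) (Finset.subset_union_left.trans Finset.subset_union_left)
  rw [isEulerOnClasses_iff] at hE
  rw [hE]
  -- Step 5: the factors, by the letters
  have haT : ArchSmooth L 3 H' T.arch := hT.isArchTest
  have hlT : ∀ v, IsLocSmooth (T.loc v) := fun v =>
    ⟨UnitaryGroup.PureTensor.isLocallyConstant_loc hT.isUnramified hT.isFinSmooth v,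
      UnitaryGroup.PureTensor.hasCompactSupport_loc hT.isUnramified hT.isFinSmooth v⟩
  have hlTH : ∀ v, IsLocSmooth (TH.loc v) := fun v => by
    by_cases hv : v ∈ TH.S
    · exact hTHs v hv
    · exact UnitaryGroup.PureTensor₂.isLocSmooth_loc_of_not_mem L TH hTH hv
  rw [harch TH.arch T.arch haT hTHa hAT,
    Finset.prod_congr rfl fun v _ => hloc v (TH.loc v) (T.loc v) (hlT v) (hlTH v) (hLT v), Finset.prod_mul_distrib]
  have hc : ∏ v ∈ S₁ ∪ Sc ∪ SH, c v = ∏ v ∈ Sc, c v :=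
    (Finset.prod_subset (Finset.subset_union_right.trans Finset.subset_union_left) fun v _ hv => hSc v hv).symm
  have hev := UnitaryGroup.PureTensor₂.arch_mul_prod_loc_eq_eval_toAdelic L TH γH (S := S₁ ∪ Sc ∪ SH)
    (hTSH.trans Finset.subset_union_right) fun v hv => hpH v fun h => hv (Finset.mem_union_right _ h)
  rw [hc, ← hev, ← hr']
  ring

end Glue

end Literature.NumberTheory.Rogawski1990

end
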